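import Literature.Analysis.FluidPDE.SereginZajaczkowski2007
import HarnessLib

/-!
# Seregin–Zajaczkowski 2007: Corollary 4.4 from Lemmas 4.2 and 4.3

G. Seregin, W. Zajaczkowski, *A sufficient condition of regularity for axially symmetric
solutions to the Navier–Stokes equations*, SIAM J. Math. Anal. 39 (2007) 669–685 =
arXiv:math/0702720 (numbers below are those of the arXiv version, §4). The parent file
`SereginZajaczkowski2007.lean` vendors Cor. 4.4 as the named fact `OffAxisL6Bound`
(`∫_{Q̃₂} |V|⁶ dz ≤ Φ₆(𝒜₂)` for sufficiently smooth axially symmetric solutions in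
`Q̃ = 𝒞(1/4, 3; 2) × ]-2², 0[`) and proves Prop. 4.1 from it and Lemma 2.3. The printed proof of
Cor. 4.4 is the single sentence "From Lemmata 4.2 and 4.3, we find", the two lemmas being

> **Lemma 4.2.** Under assumptions of Proposition 4.1, there exists a function
> `Φ₁ : ℝ₊ × ℝ₊ → ℝ₊`, non-decreasing in each variable, such that
> `sup_{-(7/4)² < t < 0} ∫_{𝒞̃₁} |V^a(x,t)|^q dx ≤ Φ₁(q, 𝒜₂)`, `1 ≤ q < +∞`.            (4.2)
> Here, `V^a = (V_ϱ, V₃)`, `|V^a| = √(|V_ϱ|² + |V₃|²)`, `𝒞̃₁ = 𝒞(5/16, 11/4; 7/4)`, and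
> `Q̃₁ = 𝒞̃₁ × ]-(7/4)², 0[`

(proof: the equation (4.5) for `χ = ω_φ` with source `(2/ϱ) V_φ V_{φ,3}`, the energy identity
(4.9) for `χ̃/ϱ`, `χ̃ = χψ`, Ladyzhenskaya's inequality in the variables `(ϱ, x₃)`, (4.10)–(4.13),
Gronwall, then the div–curl relations (4.6)–(4.7) for `Ṽ = V^a ψ` and the two-dimensional
Sobolev inequality), and

> **Lemma 4.3.** Under assumptions of Proposition 4.1, there exists a non decreasing function
> `Φ₅ : ℝ₊ → ℝ₊` such that `∫_{Q̃₂} |V_φ|⁶ dz ≤ Φ₅(𝒜₂)`,                                    (4.14)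
> where `Q̃₂ = 𝒞̃₂ × ]-(3/2)², 0[` and `𝒞̃₂ = 𝒞(3/8, 5/2; 3/2)`

(proof: the swirl equation (4.15), the energy identity (4.16) for `α̃ = ϱ V_φ ψ`, the
multiplicative inequality (4.17), Lemma 4.2 at `q = 4`, Young, (4.18)).

This file vendors Lemma 4.2 (`OffAxisPoloidalBound`) and Lemma 4.3 (`OffAxisSwirlL6Bound`) as
named facts, for the same hypothesis class `IsSmoothAxisymmetricSolutionOn Q̃ V P` and the same
functional `𝒜₂ = SereginSverak2009.szEnergy V P (D_x V)` as `OffAxisL6Bound`, and PROVES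
Cor. 4.4 from them: `offAxisL6Bound_of : OffAxisPoloidalBound → OffAxisSwirlL6Bound →
OffAxisL6Bound`. The proof is the one the sentence "From Lemmata 4.2 and 4.3" stands for: off the
axis `|V|² = |V^a|² + |V_φ|²` (the cylindrical frame is orthonormal), so
`|V|⁶ ≤ 4 (|V^a|⁶ + |V_φ|⁶)`; `𝒞̃₂ ⊆ 𝒞̃₁` and `]-(3/2)², 0[ ⊆ ]-(7/4)², 0[`, so by Tonelli
`∫_{Q̃₂} |V^a|⁶ dz ≤ (3/2)² sup_t ∫_{𝒞̃₁} |V^a|⁶ dx ≤ (9/4) Φ₁(6, 𝒜₂)`; hence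
`Φ₆ = 4 ((9/4) Φ₁(6, ·) + Φ₅)`, non-decreasing.

## Rendering choices (as in the parent file; conclusions weaker than or equal to the print)

* `Φ₁`, `Φ₅` are chosen BEFORE the solution and fed an upper bound `K ≥ 𝒜₂` in `ℝ≥0`
  ("non-decreasing" makes `≤ Φ(𝒜₂)` and "`≤ Φ(K)` whenever `𝒜₂ ≤ K`" the same statement).
* (4.2) is rendered for every `t ∈ ]-(7/4)², 0[` (the printed `sup_t`; for the continuous fields
  of the class the map `t ↦ ∫_{𝒞̃₁} |V^a|^q` is lower semicontinuous, so this is also the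
  essential supremum) and every real `q ≥ 1` (`q : ℝ≥0`, exponent `(q : ℝ)`); "non-decreasing in
  each variable" is recorded as monotonicity of `Φ₁` in `q` and in `K` separately.
* `|V^a| = poloidalSpeed (V t) x = √(V_ϱ² + V₃²)` with the accepted components
  `radialVelocity = ⟪V, e_ϱ⟫`, `axialVelocity = V₃`; `V_φ = swirlVelocity (V t) x = ⟪V, e_φ⟫`
  (accepted; junk value `0` on the axis, irrelevant on the shells, which avoid the axis).
* Geometry: `𝒞̃₁ = shell (5/16) (11/4) (7/4)`, `Q̃₂ = shellCyl (3/8) (5/2) (3/2) (3/2)` (accepted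
  `shell`, `shellCyl` of the parent file).

## Contents

* `poloidalSpeed` and the component algebra off the axis (`radialVelocity_eq_div`,
  `swirlVelocity_eq_div`, `norm_sq_eq_poloidalSpeed_sq_add_swirlVelocity_sq`,
  `norm_pow_six_le`);
* the named facts `OffAxisPoloidalBound` (Lemma 4.2) and `OffAxisSwirlL6Bound` (Lemma 4.3);
* the proved `offAxisL6Bound_of` (Cor. 4.4 from Lemmas 4.2 and 4.3).

## Not here

The discharges of Lemmas 4.2 and 4.3 (the energy method of §4: (4.3)–(4.13), (4.15)–(4.18)).

## References

* G. Seregin, W. Zajaczkowski, SIAM J. Math. Anal. 39 (2007) 669–685, arXiv:math/0702720, §4: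
  Prop. 4.1 (hypotheses, `𝒜₂`), Lemma 4.2 ((4.2), `V^a`, `𝒞̃₁`, `Q̃₁`), Lemma 4.3 ((4.14), `Q̃₂`,
  `𝒞̃₂`), Cor. 4.4 ((4.19)) and the sentence "From Lemmata 4.2 and 4.3, we find".
  [`SereginZajaczkowski2007`]
-/

noncomputable section

open MeasureTheory Set Function Filter Topology TopologicalSpace Metric WithLp
open scoped NNReal ENNReal ContDiff InnerProductSpace RealInnerProductSpace

namespace Literature.Analysis.FluidPDE

namespace SereginZajaczkowski2007

open SereginSverak2009

/-- Local notation for physical space `ℝ³ = EuclideanSpace ℝ (Fin 3)`. -/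
local notation "ℝ³" => EuclideanSpace ℝ (Fin 3)

/-! ### The poloidal part `V^a = (V_ϱ, V₃)` and the component algebra off the axis -/

/-- The poloidal speed `|V^a| = √(|V_ϱ|² + |V₃|²)` of a vector field, `V^a = (V_ϱ, V₃)`, with the
accepted cylindrical components `V_ϱ = radialVelocity V x = ⟪V x, e_ϱ x⟫` and
`V₃ = axialVelocity V x = V x 2` (Seregin–Zajaczkowski 2007, Lemma 4.2: "`V^a = (V_ϱ, V₃)`,
`|V^a| = √(|V_ϱ|² + |V₃|²)`"). On the axis `radialVelocity` has the junk value `0`, so there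
`poloidalSpeed V x = |V x 2|`; the shells of §4 avoid the axis.
[cite: SereginZajaczkowski2007, Lemma 4.2 (definition of V^a and |V^a|)] -/
def poloidalSpeed (u : ℝ³ → ℝ³) (x : ℝ³) : ℝ :=
  Real.sqrt (radialVelocity u x ^ 2 + axialVelocity u x ^ 2)

/-- `|V^a| ≥ 0`. [folklore] -/
theorem poloidalSpeed_nonneg (u : ℝ³ → ℝ³) (x : ℝ³) : 0 ≤ poloidalSpeed u x :=
  Real.sqrt_nonneg _

/-- `|V^a|² = V_ϱ² + V₃²`. [folklore] -/
theorem poloidalSpeed_sq (u : ℝ³ → ℝ³) (x : ℝ³) :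
    poloidalSpeed u x ^ 2 = radialVelocity u x ^ 2 + axialVelocity u x ^ 2 :=
  Real.sq_sqrt (by positivity)

/-- `V_ϱ = (x₀ V₀ + x₁ V₁) / ϱ` (off the axis; on the axis both sides are `0`). [folklore] -/
theorem radialVelocity_eq_div (u : ℝ³ → ℝ³) (x : ℝ³) :
    radialVelocity u x = (x 0 * u x 0 + x 1 * u x 1) / cylRadius x := by
  simp only [radialVelocity, eR, inner_smul_right, PiLp.inner_apply, RCLike.inner_apply,
    conj_trivial, Fin.sum_univ_three, Matrix.cons_val_zero, Matrix.cons_val_one,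
    Matrix.cons_val_two, Matrix.head_cons, Matrix.tail_cons]
  rw [div_eq_inv_mul]
  ring

/-- `V_φ = (x₀ V₁ - x₁ V₀) / ϱ` (off the axis; on the axis both sides are `0`). [folklore] -/
theorem swirlVelocity_eq_div (u : ℝ³ → ℝ³) (x : ℝ³) :
    swirlVelocity u x = (x 0 * u x 1 - x 1 * u x 0) / cylRadius x := by
  simp only [swirlVelocity, eTheta, inner_smul_right, PiLp.inner_apply, RCLike.inner_apply,
    conj_trivial, Fin.sum_univ_three, Matrix.cons_val_zero, Matrix.cons_val_one,
    Matrix.cons_val_two, Matrix.head_cons, Matrix.tail_cons]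
  rw [div_eq_inv_mul]
  ring

/-- `V₃ = V x 2`, unfolded. [folklore] -/
theorem axialVelocity_eq (u : ℝ³ → ℝ³) (x : ℝ³) : axialVelocity u x = u x 2 :=
  rfl

/-- Off the axis the horizontal speed splits: `V_ϱ² + V_φ² = V₀² + V₁²`. [folklore] -/
theorem radialVelocity_sq_add_swirlVelocity_sq (u : ℝ³ → ℝ³) {x : ℝ³} (hx : cylRadius x ≠ 0) :
    radialVelocity u x ^ 2 + swirlVelocity u x ^ 2 = u x 0 ^ 2 + u x 1 ^ 2 := by
  have hr := cylRadius_sq x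
  rw [radialVelocity_eq_div, swirlVelocity_eq_div, div_pow, div_pow, ← add_div,
    div_eq_iff (pow_ne_zero 2 hx), hr]
  ring

/-- **The cylindrical frame is orthonormal off the axis**: `|V|² = |V^a|² + |V_φ|²`, i.e.
`|V|² = V_ϱ² + V₃² + V_φ²` for `ϱ ≠ 0` (Seregin–Zajaczkowski 2007, §1:
`v = v_ϱ e_ϱ + v_φ e_φ + v₃ e₃`). [cite: SereginZajaczkowski2007, §1 (cylindrical decomposition)] -/
theorem norm_sq_eq_poloidalSpeed_sq_add_swirlVelocity_sq (u : ℝ³ → ℝ³) {x : ℝ³}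
    (hx : cylRadius x ≠ 0) :
    ‖u x‖ ^ 2 = poloidalSpeed u x ^ 2 + swirlVelocity u x ^ 2 := by
  rw [poloidalSpeed_sq, add_right_comm, radialVelocity_sq_add_swirlVelocity_sq u hx,
    axialVelocity_eq, EuclideanSpace.norm_eq, Real.sq_sqrt (by positivity)]
  simp only [Fin.sum_univ_three, Real.norm_eq_abs, sq_abs]

/-- **`|V|⁶ ≤ 4 (|V^a|⁶ + |V_φ|⁶)` off the axis** (from `|V|² = |V^a|² + |V_φ|²` and
`(a + b)³ ≤ 4(a³ + b³)` for `a, b ≥ 0`, i.e. `(a + b)(a - b)² ≥ 0` — the accepted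
`Torus.add_pow_three_le`, inlined here to keep the imports light): the pointwise inequality
behind "From Lemmata 4.2 and 4.3, we find" Cor. 4.4. [cite: SereginZajaczkowski2007, Cor. 4.4 (proof)] -/
theorem norm_pow_six_le (u : ℝ³ → ℝ³) {x : ℝ³} (hx : cylRadius x ≠ 0) :
    ‖u x‖ ^ 6 ≤ 4 * (poloidalSpeed u x ^ 6 + swirlVelocity u x ^ 6) := by
  have h2 := norm_sq_eq_poloidalSpeed_sq_add_swirlVelocity_sq u hx
  set a := poloidalSpeed u x ^ 2 with ha
  set b := swirlVelocity u x ^ 2 with hb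
  have ha0 : 0 ≤ a := sq_nonneg _
  have hb0 : 0 ≤ b := sq_nonneg _
  have e1 : ‖u x‖ ^ 6 = (a + b) ^ 3 := by rw [← h2]; ring
  have e2 : poloidalSpeed u x ^ 6 = a ^ 3 := by rw [ha]; ring
  have e3 : swirlVelocity u x ^ 6 = b ^ 3 := by rw [hb]; ring
  rw [e1, e2, e3]
  nlinarith [mul_nonneg (add_nonneg ha0 hb0) (sq_nonneg (a - b)), mul_nonneg ha0 hb0]

/-! ### Lemma 4.2 and Lemma 4.3 as named facts -/

/-- **Seregin–Zajaczkowski 2007, Lemma 4.2.** "Under assumptions of Proposition 4.1, there exists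
a function `Φ₁ : ℝ₊ × ℝ₊ → ℝ₊`, non-decreasing in each variable, such that
`sup_{-(7/4)² < t < 0} ∫_{𝒞̃₁} |V^a(x,t)|^q dx ≤ Φ₁(q, 𝒜₂)`, `1 ≤ q < +∞`. Here,
`V^a = (V_ϱ, V₃)`, `|V^a| = √(|V_ϱ|² + |V₃|²)`, `𝒞̃₁ = 𝒞(5/16, 11/4; 7/4)`, and
`Q̃₁ = 𝒞̃₁ × ]-(7/4)², 0[`." The assumptions of Prop. 4.1 are "`V` and `P` [are] a sufficiently
smooth axially symmetric solution to the Navier–Stokes equations in `Q̃ = 𝒞̃ × ]-2², 0[`,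
`𝒞̃ = 𝒞(1/4, 3; 2)`", and `𝒜₂ = sup_{-2²<t<0} ∫_𝒞̃ |V|² dx + ∫_Q̃ (|∇V|² + |V|³ + |P|^{3/2}) dz`
(proof there: the equation (4.5) for `χ = ω_φ`, the energy identity (4.9) for `χ̃/ϱ` with a
cut-off `ψ`, Ladyzhenskaya's inequality in `(ϱ, x₃)`, (4.10)–(4.13), Gronwall; then (4.6)–(4.7)
and the two-dimensional Sobolev inequality). Rendered (module docstring): the assumptions are the
accepted `IsSmoothAxisymmetricSolutionOn Q̃ V P` (as for `OffAxisL6Bound`); `𝒜₂` is the accepted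
`SereginSverak2009.szEnergy V P (D_x V)`; `Φ₁ : ℝ≥0 → ℝ≥0 → ℝ≥0` is chosen before the solution,
monotone in each variable, and fed `q` and an upper bound `K ≥ 𝒜₂`; the bound holds for every
`t ∈ ]-(7/4)², 0[` and every real `q ≥ 1`, with `|V^a| = poloidalSpeed (V t) x` and
`𝒞̃₁ = shell (5/16) (11/4) (7/4)`.
[cite: SereginZajaczkowski2007, Lemma 4.2 ((4.2))] -/
def OffAxisPoloidalBound : Prop :=
  ∃ Φ₁ : ℝ≥0 → ℝ≥0 → ℝ≥0, (∀ q, Monotone (Φ₁ q)) ∧ (∀ K, Monotone fun q => Φ₁ q K) ∧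
    ∀ (V : ℝ → ℝ³ → ℝ³) (P : ℝ → ℝ³ → ℝ),
      IsSmoothAxisymmetricSolutionOn (shellCylOpens (1 / 4) 3 2 2) V P →
      ∀ K : ℝ≥0, szEnergy V P (fun t x => fderiv ℝ (V t) x) ≤ K →
        ∀ q : ℝ≥0, 1 ≤ q → ∀ t ∈ Ioo (-(7 / 4 : ℝ) ^ 2) 0,
          ∫⁻ x in shell (5 / 16) (11 / 4) (7 / 4), ‖poloidalSpeed (V t) x‖ₑ ^ (q : ℝ) ≤ Φ₁ q K

/-- **Seregin–Zajaczkowski 2007, Lemma 4.3.** "Under assumptions of Proposition 4.1, there exists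
a non decreasing function `Φ₅ : ℝ₊ → ℝ₊` such that `∫_{Q̃₂} |V_φ|⁶ dz ≤ Φ₅(𝒜₂)`, where
`Q̃₂ = 𝒞̃₂ × ]-(3/2)², 0[` and `𝒞̃₂ = 𝒞(3/8, 5/2; 3/2)`" (proof there: the swirl equation (4.15),
the energy identity (4.16) for `α̃ = ϱ V_φ ψ` with a cut-off `ψ` equal to `1` in `Q̃₂`, the
multiplicative inequality (4.17), Lemma 4.2 at `q = 4`, Young's inequality and (4.18)). Rendered
(module docstring): assumptions `IsSmoothAxisymmetricSolutionOn Q̃ V P`, `𝒜₂ = szEnergy V P (D_x V)`,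
`Φ₅` chosen before the solution and fed an upper bound `K ≥ 𝒜₂`; `V_φ = swirlVelocity (V t) x`
(accepted), `Q̃₂ = shellCyl (3/8) (5/2) (3/2) (3/2)`.
[cite: SereginZajaczkowski2007, Lemma 4.3 ((4.14))] -/
def OffAxisSwirlL6Bound : Prop :=
  ∃ Φ₅ : ℝ≥0 → ℝ≥0, Monotone Φ₅ ∧
    ∀ (V : ℝ → ℝ³ → ℝ³) (P : ℝ → ℝ³ → ℝ),
      IsSmoothAxisymmetricSolutionOn (shellCylOpens (1 / 4) 3 2 2) V P →
      ∀ K : ℝ≥0, szEnergy V P (fun t x => fderiv ℝ (V t) x) ≤ K →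
        ∫⁻ z in shellCyl (3 / 8) (5 / 2) (3 / 2) (3 / 2),
          ‖swirlVelocity (V z.1) z.2‖ₑ ^ (6 : ℕ) ≤ Φ₅ K

/-! ### Proved: Corollary 4.4 from Lemmas 4.2 and 4.3 -/

/-- The shell cylinders are products (time first): `𝒞(R₁,R₂;a) × ]-b²,0[ = ]-b²,0[ ×ˢ 𝒞(R₁,R₂;a)`.
[folklore] -/
theorem shellCyl_eq_prod (R₁ R₂ a b : ℝ) :
    shellCyl R₁ R₂ a b = Ioo (-b ^ 2) 0 ×ˢ shell R₁ R₂ a :=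
  rfl

/-- `𝒞̃₂ = 𝒞(3/8, 5/2; 3/2) ⊆ 𝒞̃₁ = 𝒞(5/16, 11/4; 7/4)`. [cite: SereginZajaczkowski2007, Cor. 4.4 (proof)] -/
theorem shell_two_subset_one : shell (3 / 8) (5 / 2) (3 / 2) ⊆ shell (5 / 16) (11 / 4) (7 / 4) := by
  intro x hx
  rw [mem_shell] at hx ⊢
  exact ⟨⟨by linarith [hx.1.1], by linarith [hx.1.2]⟩, by linarith [hx.2]⟩

/-- Points of a shell `𝒞(R₁, R₂; a)` with `R₁ ≥ 0` lie off the axis. [folklore] -/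
theorem cylRadius_ne_zero_of_mem_shell {R₁ R₂ a : ℝ} (hR : 0 ≤ R₁) {x : ℝ³}
    (hx : x ∈ shell R₁ R₂ a) : cylRadius x ≠ 0 :=
  (hR.trans_lt hx.1.1).ne'

/-- **A sliced bound integrates** (Tonelli in the inequality form, no measurability needed): if
`∫_S f(t, ·) ≤ C` for every `t ∈ I`, then `∫_{I ×ˢ S} f ≤ C · |I|`. [folklore] -/
theorem setLIntegral_prod_le_of_forall_slice_le {f : ℝ × ℝ³ → ℝ≥0∞} {I : Set ℝ} {S : Set ℝ³}
    (hI : MeasurableSet I) {C : ℝ≥0∞} (h : ∀ t ∈ I, ∫⁻ x in S, f (t, x) ≤ C) :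
    ∫⁻ z in I ×ˢ S, f z ≤ C * volume I := by
  calc ∫⁻ z in I ×ˢ S, f z
      = ∫⁻ z, f z ∂((volume.restrict I).prod (volume.restrict S)) := by
        rw [Measure.prod_restrict, ← Measure.volume_eq_prod]
    _ ≤ ∫⁻ t in I, ∫⁻ x in S, f (t, x) := lintegral_prod_le _
    _ ≤ ∫⁻ _ in I, C := setLIntegral_mono' hI fun t ht => h t ht
    _ = C * volume I := by rw [setLIntegral_const]

/-- `‖x‖ₑ ^ 6 = ofReal (x ^ 6)` for a real number `x` (an even power). [folklore] -/
theorem enorm_pow_six_eq_ofReal (x : ℝ) : ‖x‖ₑ ^ (6 : ℕ) = ENNReal.ofReal (x ^ 6) := by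
  rw [Real.enorm_eq_ofReal_abs, ← ENNReal.ofReal_pow (abs_nonneg x)]
  congr 1
  rw [show (6 : ℕ) = 2 * 3 from rfl, pow_mul, pow_mul, sq_abs]

/-- **Seregin–Zajaczkowski 2007, Corollary 4.4, proved from Lemmas 4.2 and 4.3** ("From Lemmata
4.2 and 4.3, we find" Cor. 4.4): off the axis `|V|⁶ ≤ 4 (|V^a|⁶ + |V_φ|⁶)`; since `𝒞̃₂ ⊆ 𝒞̃₁` and
`]-(3/2)², 0[ ⊆ ]-(7/4)², 0[`, Lemma 4.2 at `q = 6` gives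
`∫_{Q̃₂} |V^a|⁶ dz ≤ (9/4) Φ₁(6, K)` by Tonelli, and Lemma 4.3 gives `∫_{Q̃₂} |V_φ|⁶ dz ≤ Φ₅(K)`;
so `∫_{Q̃₂} |V|⁶ dz ≤ Φ₆(K)` with the non-decreasing `Φ₆ = 4 ((9/4) Φ₁(6, ·) + Φ₅)`.
[cite: SereginZajaczkowski2007, Cor. 4.4 ((4.19)) and its proof] -/
theorem offAxisL6Bound_of (h42 : OffAxisPoloidalBound) (h43 : OffAxisSwirlL6Bound) :
    OffAxisL6Bound := by
  obtain ⟨Φ₁, hΦ₁K, hΦ₁q, h42⟩ := h42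
  obtain ⟨Φ₅, hΦ₅, h43⟩ := h43
  refine ⟨fun K => 4 * ((9 / 4 : ℝ≥0) * Φ₁ 6 K + Φ₅ K), ?_, ?_⟩
  · intro K K' hKK'
    dsimp only
    gcongr
    · exact hΦ₁K 6 hKK'
    · exact hΦ₅ hKK'
  intro V P hV K hK
  -- the geometry of `Q̃₂` and continuity of `V` there
  have hsub : shellCyl (3 / 8) (5 / 2) (3 / 2) (3 / 2) ⊆
      (shellCylOpens (1 / 4) 3 2 2 : Set (ℝ × ℝ³)) := shellCyl_two_subset_tilde
  have hoff : ∀ z ∈ shellCyl (3 / 8) (5 / 2) (3 / 2) (3 / 2), cylRadius z.2 ≠ 0 := fun z hz =>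
    cylRadius_ne_zero_of_mem_shell (by norm_num) hz.2
  have hVc : ContinuousOn (fun z : ℝ × ℝ³ => V z.1 z.2) (shellCyl (3 / 8) (5 / 2) (3 / 2) (3 / 2)) :=
    hV.continuousOn_velocity.mono hsub
  -- measurability of the swirl integrand on `Q̃₂` (continuity off the axis)
  have hsw : AEMeasurable (fun z : ℝ × ℝ³ => ‖swirlVelocity (V z.1) z.2‖ₑ ^ (6 : ℕ))
      (volume.restrict (shellCyl (3 / 8) (5 / 2) (3 / 2) (3 / 2))) := by
    have hc : ContinuousOn (fun z : ℝ × ℝ³ => swirlVelocity (V z.1) z.2)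
        (shellCyl (3 / 8) (5 / 2) (3 / 2) (3 / 2)) := by
      have heq : (fun z : ℝ × ℝ³ => swirlVelocity (V z.1) z.2) = fun z =>
          (z.2 0 * V z.1 z.2 1 - z.2 1 * V z.1 z.2 0) / cylRadius z.2 := by
        funext z
        exact swirlVelocity_eq_div (V z.1) z.2
      rw [heq]
      refine ContinuousOn.div ?_ (continuous_cylRadius.comp_continuousOn continuousOn_snd) hoff
      have h0 : ContinuousOn (fun z : ℝ × ℝ³ => V z.1 z.2 0) _ :=
        (EuclideanSpace.proj (0 : Fin 3)).continuous.comp_continuousOn hVc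
      have h1 : ContinuousOn (fun z : ℝ × ℝ³ => V z.1 z.2 1) _ :=
        (EuclideanSpace.proj (1 : Fin 3)).continuous.comp_continuousOn hVc
      have hx0 : ContinuousOn (fun z : ℝ × ℝ³ => z.2 0) (shellCyl (3 / 8) (5 / 2) (3 / 2) (3 / 2)) :=
        ((EuclideanSpace.proj (0 : Fin 3)).continuous.comp continuous_snd).continuousOn
      have hx1 : ContinuousOn (fun z : ℝ × ℝ³ => z.2 1) (shellCyl (3 / 8) (5 / 2) (3 / 2) (3 / 2)) :=
        ((EuclideanSpace.proj (1 : Fin 3)).continuous.comp continuous_snd).continuousOn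
      exact (hx0.mul h1).sub (hx1.mul h0)
    exact ((hc.aemeasurable (measurableSet_shellCyl _ _ _ _)).enorm.pow_const _)
  -- the pointwise inequality `|V|⁶ ≤ 4 (|V^a|⁶ + |V_φ|⁶)` in `ℝ≥0∞`
  have hpt : ∀ z ∈ shellCyl (3 / 8) (5 / 2) (3 / 2) (3 / 2),
      ‖V z.1 z.2‖ₑ ^ (6 : ℕ) ≤ 4 * (‖poloidalSpeed (V z.1) z.2‖ₑ ^ (6 : ℕ) +
        ‖swirlVelocity (V z.1) z.2‖ₑ ^ (6 : ℕ)) := by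
    intro z hz
    have h := norm_pow_six_le (V z.1) (hoff z hz)
    have hp0 : 0 ≤ poloidalSpeed (V z.1) z.2 ^ 6 := by positivity
    have hs0 : 0 ≤ swirlVelocity (V z.1) z.2 ^ 6 := by positivity
    calc ‖V z.1 z.2‖ₑ ^ (6 : ℕ) = ENNReal.ofReal (‖V z.1 z.2‖ ^ 6) := by
          rw [← ofReal_norm, ENNReal.ofReal_pow (norm_nonneg _)]
      _ ≤ ENNReal.ofReal (4 * (poloidalSpeed (V z.1) z.2 ^ 6 + swirlVelocity (V z.1) z.2 ^ 6)) :=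
          ENNReal.ofReal_le_ofReal h
      _ = 4 * (‖poloidalSpeed (V z.1) z.2‖ₑ ^ (6 : ℕ) +
            ‖swirlVelocity (V z.1) z.2‖ₑ ^ (6 : ℕ)) := by
          rw [ENNReal.ofReal_mul (by norm_num), ENNReal.ofReal_add hp0 hs0,
            enorm_pow_six_eq_ofReal, enorm_pow_six_eq_ofReal, ENNReal.ofReal_ofNat]
  -- Lemma 4.2 at `q = 6`, integrated over `]-(3/2)², 0[`
  have hpol : ∫⁻ z in shellCyl (3 / 8) (5 / 2) (3 / 2) (3 / 2),
      ‖poloidalSpeed (V z.1) z.2‖ₑ ^ (6 : ℕ) ≤ ((9 / 4 : ℝ≥0) * Φ₁ 6 K : ℝ≥0) := by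
    have hq : (1 : ℝ≥0) ≤ 6 := by norm_num
    have hslice : ∀ t ∈ Ioo (-(3 / 2 : ℝ) ^ 2) 0, ∫⁻ x in shell (3 / 8) (5 / 2) (3 / 2),
        ‖poloidalSpeed (V t) x‖ₑ ^ (6 : ℕ) ≤ Φ₁ 6 K := by
      intro t ht
      have ht' : t ∈ Ioo (-(7 / 4 : ℝ) ^ 2) 0 := ⟨by linarith [ht.1], ht.2⟩
      have h6 := h42 V P hV K hK 6 hq t ht'
      refine le_trans (lintegral_mono_set shell_two_subset_one) (le_trans (le_of_eq ?_) h6)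
      refine lintegral_congr fun x => ?_
      rw [show ((6 : ℝ≥0) : ℝ) = ((6 : ℕ) : ℝ) by norm_num, ENNReal.rpow_natCast]
    have hI : volume (Ioo (-(3 / 2 : ℝ) ^ 2) 0) = ((9 / 4 : ℝ≥0) : ℝ≥0∞) := by
      rw [Real.volume_Ioo, ← ENNReal.ofReal_coe_nnreal]
      congr 1
      norm_num
    rw [shellCyl_eq_prod]
    refine (setLIntegral_prod_le_of_forall_slice_le measurableSet_Ioo hslice).trans ?_
    rw [hI, ENNReal.coe_mul, mul_comm]
  -- Lemma 4.3
  have hswirl := h43 V P hV K hK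
  -- assembling
  calc ∫⁻ z in shellCyl (3 / 8) (5 / 2) (3 / 2) (3 / 2), ‖V z.1 z.2‖ₑ ^ (6 : ℕ)
      ≤ ∫⁻ z in shellCyl (3 / 8) (5 / 2) (3 / 2) (3 / 2),
          4 * (‖poloidalSpeed (V z.1) z.2‖ₑ ^ (6 : ℕ) + ‖swirlVelocity (V z.1) z.2‖ₑ ^ (6 : ℕ)) :=
        setLIntegral_mono' (measurableSet_shellCyl _ _ _ _) hpt
    _ = 4 * ((∫⁻ z in shellCyl (3 / 8) (5 / 2) (3 / 2) (3 / 2),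
          ‖poloidalSpeed (V z.1) z.2‖ₑ ^ (6 : ℕ)) +
          ∫⁻ z in shellCyl (3 / 8) (5 / 2) (3 / 2) (3 / 2),
            ‖swirlVelocity (V z.1) z.2‖ₑ ^ (6 : ℕ)) := by
        rw [lintegral_const_mul' _ _ (by norm_num), lintegral_add_right' _ hsw]
    _ ≤ 4 * (((9 / 4 : ℝ≥0) * Φ₁ 6 K : ℝ≥0) + (Φ₅ K : ℝ≥0∞)) := by
        gcongr
    _ = ((4 * ((9 / 4 : ℝ≥0) * Φ₁ 6 K + Φ₅ K) : ℝ≥0) : ℝ≥0∞) := by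
        push_cast
        ring

end SereginZajaczkowski2007

end Literature.Analysis.FluidPDE
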